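import Literature.AlgebraicGeometry.Frobenioids.ArithmeticFrobenioidThm64ivSchema
import Literature.AlgebraicGeometry.Frobenioids.ArithmeticRealificationFrobeniusTrivial
import Literature.AlgebraicGeometry.Frobenioids.ArithmeticRealificationInstanceDelta
import Literature.AlgebraicGeometry.Frobenioids.ArithmeticFrobenioidThm64ivNormPreservation
import Literature.AlgebraicGeometry.Frobenioids.ArithmeticFrobenioidThm64iiAtData
import Literature.AlgebraicGeometry.Frobenioids.Cor54SubTransportProofs
import Literature.AlgebraicGeometry.Frobenioids.Cor54SubRealSpanCompatProofs
import Literature.AlgebraicGeometry.Frobenioids.Prop53SubProofs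
import Literature.AlgebraicGeometry.Frobenioids.ArithmeticFrobenioidThm64iii
import HarnessLib

/-!
# Frobenioids I, Theorem 6.4 (iv) — the typed schema `Thm64iv` AT THE CONSTRUCTIONS, for an equivalence
# `Ψ : C_{K₁/F₁} ⥲ C_{K₂/F₂}` of arithmetic Frobenioids with its Cor. 4.11 (iv) datum
# (row «T64-ASSEMBLIES», the composition for (iv); binder form over the datum)

Mochizuki, *The geometry of Frobenioids I: the general theory*, Kyushu J. Math. **62** (2008) 293–400, §6,
Thm. 6.4 (iv), kurims text p. 115 l. 17–29: "Suppose that `Ψ^rlf` arises from an equivalence of categories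
`Ψ : C₁ ⥲ C₂`. Then `deg(Ψ^rlf) = 1`. If, moreover, there exists a finite extension `L₁ ⊆ F̃₁` of `F₁` which is
Galois over `ℚ`, then the corresponding … `L₂ ⊆ F̃₂` of `F₂` is isomorphic to `L₁` in a fashion that is compatible
with an isomorphism `F₁ ⥲ F₂`"; proof p. 116 l. 17–35. [cite: MochizukiFrdI2008, Thm. 6.4 (iv) p.115]

PROOF-ONLY composition (cell abc-iut, `plan/L1/SUBDAG-FrdI-Thm64.md`; L1-lead R112 (9) / R114 (2): row
«T64-ASSEMBLIES» = seat abc-iut-L1-t3, the typer of the schema; 0 `def`, no instance, no notation, no named fact).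
Everything is at THE data and consumed BY NAME; the only binders are the components of the [FrdI] Cor. 4.11 (iv)
DATUM of `Ψ` — `Ψ^Base` (a functor that is an equivalence), `E = Ψ^Φ` over it, `η : Base₂ ∘ Ψ ≅ Ψ^Base ∘ Base₁`, the
`Div`-clause, and the finite-place bijections `π` with "generator ↦ generator" — exactly the components delivered
binder-free by abc-iut-L1-d7's `exists_transport_of_cor411iv` (from the typed Cor. 4.11 (iv), which HOLDS at `C_{K/F}`:
abc-iut-L1-d1's `cor411iv_arith`; the ∃-packaged corollary is the companion file
`ArithmeticFrobenioidThm64ivAtDataUnconditional.lean`, filed when those modules are served):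
* `C_i = C_{K_i/F_i} = arithFrobenioid F_i K_i` (abc-iut-L6-t10), `M_i = arithModelFrobenioid F_i K_i`;
* abc-iut-L1-d7's `arith_biratCompat_of_cor411iv` (`Ψ^Φ` respects `Φ^birat`; [FrdI] Cor. 4.10 / Thm. 3.4 (ii));
* [FrdI] Cor. 5.4 at `C_{K/F}` — the W3 sub-DAG lane (abc-iut-w5-d137 / w5-d097 / w5-d221 / L1-d2):
  `FrdI.Cor54Sub.rlfIso` (`(Ψ^Φ)^rlf`), `rlfIso_toRlf`, `realSpanCompat_holds` (`ℝ · Φ^birat` respected),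
  `rlfTransport_holds` (THE induced equivalence `Ψ^rlf : C₁^rlf ⥲ C₂^rlf` over `Ψ^Base`, preserving Frobenius degrees,
  carrying `Div` by `(Ψ^Φ)^rlf`);
* THE realifications with `Pic_Φ`, `δ_A` — abc-iut-L1-d2's `arithRealification hΦ_i` — and [FrdI] Thm. 6.4 (ii) AT
  THE DATA — abc-iut-w4-d086's `ArithFrd.exists_picMap_thm64ii` (THE induced `picMap`, `Thm64ii`, and the readings of
  `picMap` / `δ` on classes of monoid elements);
* abc-iut-L1-t3's `arithRealification_isFrobeniusTrivial_zero` / `arithRealification_isFrobeniusTrivial_map`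
  (Frobenius-trivial objects over every `Spec L`, preserved by `Ψ^rlf`) and abc-iut-L1-d2's
  `arithRealification_δ_single_inr_logNorm` (`δ_A[ι δ_w] = log N(w)`), `ArithRlfPic.picDegree_mk_iota`;
* and the schema-letter closers `Thm64iv_of_generatorReadings` / `…_of_baseIso` / `Thm64iv_degOne_and_fieldIso_…`
  (`ArithmeticFrobenioidThm64ivSchema.lean`).

RESULT `Thm64iv_arith_of_datum` (and `…_of_baseIso`): for THE induced `Ψ^rlf`, `picMap` — which satisfy `Thm64ii` —
the typed `Thm64iv R₁ R₂ Ψrlf picMap deg M₁ M₂ r₁ r₂ Ψ ΨBase` holds for EVERY `deg` and every pair of comparison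
functors `r_i` (its `Thm64iiDeg`-antecedent pins `deg` to THE degree through the generator readings; its
`OneCommutes`-antecedent is idle, as in print, where it expresses "arises from"), when `F₁` is Galois over `ℚ`
(row T64iv/L07b discharged in that case by abc-iut-L1-d4) or an isomorphism `F₁ ≅ F₂` is given (GAP-LEDGER G-L1t3-1
otherwise); and `Thm64iv_degOne_of_datum`: THE degree of THE `Ψ^rlf` is `1`, with no hypothesis on `F₁`, `F₂`.
Nothing here bears on, or takes a side on, [IUTchIII] Cor. 3.12; no statement of the paper is strengthened.
-/

noncomputable section

open scoped NNReal

namespace Literature.AlgebraicGeometry.Frobenioids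

open CategoryTheory Opposite Function NumberField Literature.AnabelianGeometry.EtaleTheta

section AtData

variable {F₁ : Type} [Field F₁] [NumberField F₁] {K₁ : Type} [Field K₁] [Algebra F₁ K₁] [IsGalois F₁ K₁]
  {F₂ : Type} [Field F₂] [NumberField F₂] {K₂ : Type} [Field K₂] [Algebra F₂ K₂] [IsGalois F₂ K₂]
  (hΦ₁ : PreFrobenioid.IsPerfFactorialOn (arithDivisorFunctor F₁ K₁))
  (hΦ₂ : PreFrobenioid.IsPerfFactorialOn (arithDivisorFunctor F₂ K₂))
  (Ψ : arithFrobenioid F₁ K₁ ≌ arithFrobenioid F₂ K₂)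
  (ΨBase : FinSubextCat F₁ K₁ ⥤ FinSubextCat F₂ K₂) [ΨBase.IsEquivalence]
  (E : (arithFrobenioidOps F₁ K₁).DivisorMonoidIsoOverBase (arithFrobenioidOps F₂ K₂) ΨBase)
  (η : Ψ.functor ⋙ (arithFrobenioidOps F₂ K₂).base ≅ (arithFrobenioidOps F₁ K₁).base ⋙ ΨBase)
  (hdiv : ∀ ⦃A B : arithFrobenioid F₁ K₁⦄ (φ : A ⟶ B),
    (arithFrobenioidOps F₂ K₂).div (Ψ.functor.map φ) =
      (arithFrobenioidOps F₂ K₂).pull (η.hom.app A)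
        (E.iso ((arithFrobenioidOps F₁ K₁).base.obj A) ((arithFrobenioidOps F₁ K₁).div φ)))
  (π : ∀ X : FinSubextCat F₁ K₁, FinitePlace X.L ≃ FinitePlace (ΨBase.obj X).L)
  (hπ : ∀ (X : FinSubextCat F₁ K₁) (w : FinitePlace X.L),
    E.iso X (Multiplicative.ofAdd (EffArithDivisor.single X.L (Sum.inr w))) =
      Multiplicative.ofAdd (EffArithDivisor.single (ΨBase.obj X).L (Sum.inr (π X w))))

include η hdiv hπ in
/-- **THE realified transport of the Cor. 4.11 (iv) datum, with the two generator readings.**  From the datum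
(`Ψ^Base`, `Ψ^Φ`, `η`, `Div`-clause, `π`) of an equivalence `Ψ : C_{K₁/F₁} ⥲ C_{K₂/F₂}` and Cor. 5.4 at `C_{K/F}`:
THE induced equivalence `Ψ^rlf : C₁^rlf ⥲ C₂^rlf` over `Ψ^Base`, THE induced `picMap` with `Thm64ii` (abc-iut-w4-d086,
Thm. 6.4 (ii) at the data), and — the input `gen` of `Thm64iv_of_generatorReadings` — over every `X = Spec L` a
Frobenius-trivial `A` with Frobenius-trivial `Ψ^rlf A` whose generator classes THE `δ`'s read as `log N(w)` and
`log N(π w)`. [cite: MochizukiFrdI2008, Thm. 6.4 (iv) p.115] -/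
theorem exists_rlfData_and_generatorReadings_of_datum :
    ∃ (Ψrlf : PreFrobenioid.rlf (ModelFrobenioid.toElem (arithDivisorFunctor F₁ K₁) (unitsFunctor F₁ K₁)
          (divNatTrans F₁ K₁)) hΦ₁ ≌
        PreFrobenioid.rlf (ModelFrobenioid.toElem (arithDivisorFunctor F₂ K₂) (unitsFunctor F₂ K₂)
          (divNatTrans F₂ K₂)) hΦ₂)
      (picMap : ∀ A, (arithRealification hΦ₁).Pic A ≃+ (arithRealification hΦ₂).Pic (Ψrlf.functor.obj A)),
      Nonempty (Ψrlf.functor ⋙ (arithRealification hΦ₂).ops.base ≅ (arithRealification hΦ₁).ops.base ⋙ ΨBase) ∧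
      Thm64ii (arithRealification hΦ₁) (arithRealification hΦ₂) Ψrlf picMap ∧
      ∀ X : FinSubextCat F₁ K₁, ∃ (A : _) (hA : (arithRealification hΦ₁).ops.IsFrobeniusTrivial A)
        (hA' : (arithRealification hΦ₂).ops.IsFrobeniusTrivial (Ψrlf.functor.obj A)),
        ∀ w : FinitePlace X.L, ∃ g : (arithRealification hΦ₁).Pic A,
          (arithRealification hΦ₁).δ A hA g = logNorm w ∧
            (arithRealification hΦ₂).δ _ hA' (picMap A g) = logNorm (π X w) := by
  -- Cor. 5.4: `(Ψ^Φ)^rlf`, the real spans, THE `Ψ^rlf`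
  let Erlf : PreFrobenioidData.DivisorMonoidIsoOverBase
      (FrdI.Cor54Sub.rlfData (ModelFrobenioid.toElem (arithDivisorFunctor F₁ K₁) (unitsFunctor F₁ K₁)
        (divNatTrans F₁ K₁)) hΦ₁)
      (FrdI.Cor54Sub.rlfData (ModelFrobenioid.toElem (arithDivisorFunctor F₂ K₂) (unitsFunctor F₂ K₂)
        (divNatTrans F₂ K₂)) hΦ₂) ΨBase.asEquivalence.functor :=
    FrdI.Cor54Sub.rlfIso
      (ModelFrobenioid.toElem (arithDivisorFunctor F₁ K₁) (unitsFunctor F₁ K₁) (divNatTrans F₁ K₁)) hΦ₁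
      (ModelFrobenioid.toElem (arithDivisorFunctor F₂ K₂) (unitsFunctor F₂ K₂) (divNatTrans F₂ K₂)) hΦ₂ E
  have hBC := arith_biratCompat_of_cor411iv Ψ E η hdiv
  have hover := FrdI.Cor54Sub.rlfIso_toRlf
    (ModelFrobenioid.toElem (arithDivisorFunctor F₁ K₁) (unitsFunctor F₁ K₁) (divNatTrans F₁ K₁)) hΦ₁
    (ModelFrobenioid.toElem (arithDivisorFunctor F₂ K₂) (unitsFunctor F₂ K₂) (divNatTrans F₂ K₂)) hΦ₂ E
  have hspan := FrdI.Cor54Sub.realSpanCompat_holds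
    (ModelFrobenioid.toElem (arithDivisorFunctor F₁ K₁) (unitsFunctor F₁ K₁) (divNatTrans F₁ K₁)) hΦ₁
    (ModelFrobenioid.toElem (arithDivisorFunctor F₂ K₂) (unitsFunctor F₂ K₂) (divNatTrans F₂ K₂)) hΦ₂ E Erlf hBC hover
  obtain ⟨Ψrlf₀, ηrlf, hEq', hdeg', hdiv'⟩ :=
    FrdI.Cor54Sub.rlfTransport_holds hΦ₁ hΦ₂ ΨBase.asEquivalence Erlf hspan
  haveI := hEq'
  -- Thm. 6.4 (ii) at the data: THE picMap
  obtain ⟨picMap, hT, -, hδ₂⟩ :=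
    ArithFrd.exists_picMap_thm64ii hΦ₁ hΦ₂ Ψrlf₀.asEquivalence ΨBase.asEquivalence ηrlf Erlf hspan
  refine ⟨Ψrlf₀.asEquivalence, picMap, ⟨ηrlf⟩, hT, fun X => ?_⟩
  -- the readings at `A = (X, 0)`
  have hA : (arithRealification hΦ₁).ops.IsFrobeniusTrivial
      (⟨X, 1⟩ : PreFrobenioid.rlf
        (ModelFrobenioid.toElem (arithDivisorFunctor F₁ K₁) (unitsFunctor F₁ K₁) (divNatTrans F₁ K₁)) hΦ₁) :=
    arithRealification_isFrobeniusTrivial_zero hΦ₁ X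
  have hA' : (arithRealification hΦ₂).ops.IsFrobeniusTrivial (Ψrlf₀.asEquivalence.functor.obj ⟨X, 1⟩) :=
    arithRealification_isFrobeniusTrivial_map hΦ₁ hΦ₂ ΨBase Erlf Ψrlf₀ ηrlf hdeg' hdiv' hA
  refine ⟨⟨X, 1⟩, hA, hA', fun w => ⟨Additive.ofMul (QuotientGroup.mk' _ (Algebra.GrothendieckGroup.of
    ((PreFrobenioid.IsPerfFactorialOn.op hΦ₁ (op X)).toRealification
      (Perfection.of _ (Multiplicative.ofAdd (EffArithDivisor.single X.L (Sum.inr w))))))),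
    arithRealification_δ_single_inr_logNorm hΦ₁ _ hA w, ?_⟩⟩
  -- `δ_{Ψ A}(picMap [ι δ_w]) = δ at Ψ^Base X of [(Ψ^Φ)^rlf (ι δ_w)] = … of [ι δ_{π w}] = log N(π w)`
  rw [hδ₂ ⟨X, 1⟩ hA']
  have hgen : Erlf.iso X ((PreFrobenioid.IsPerfFactorialOn.op hΦ₁ (op X)).toRealification
        (Perfection.of _ (Multiplicative.ofAdd (EffArithDivisor.single X.L (Sum.inr w))))) =
      (PreFrobenioid.IsPerfFactorialOn.op hΦ₂ (op (ΨBase.obj X))).toRealification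
        (Perfection.of _ (Multiplicative.ofAdd (EffArithDivisor.single (ΨBase.obj X).L (Sum.inr (π X w))))) := by
    have h := hover X (Multiplicative.ofAdd (EffArithDivisor.single X.L (Sum.inr w)))
    erw [hπ X w] at h
    exact h
  show Multiplicative.toAdd (ArithRlfPic.picDegree hΦ₂ (ΨBase.obj X) (QuotientGroup.mk' _
    (Algebra.GrothendieckGroup.of (Erlf.iso X ((PreFrobenioid.IsPerfFactorialOn.op hΦ₁ (op X)).toRealification
      (Perfection.of _ (Multiplicative.ofAdd (EffArithDivisor.single X.L (Sum.inr w))))))))) = logNorm (π X w)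
  rw [hgen, ArithRlfPic.picDegree_mk_iota, toAdd_ofAdd,
    show EffArithDivisor.single (ΨBase.obj X).L (Sum.inr (π X w)) =
      ((Finsupp.single (π X w) 1, 0) : EffArithDivisor (ΨBase.obj X).L) from rfl,
    EffArithDivisor.arithDegree_single_inr, Nat.cast_one, one_mul]

include η hdiv hπ in
/-- **[FrdI] Theorem 6.4 (iv) AS TYPED (`Thm64iv`), AT THE CONSTRUCTIONS, over the Cor. 4.11 (iv) datum of an
equivalence `Ψ : C_{K₁/F₁} ⥲ C_{K₂/F₂}` — `F₁` Galois over `ℚ`.**  For THE induced `Ψ^rlf`, `picMap` (which satisfy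
Thm. 6.4 (ii), `Thm64ii`), the schema `Thm64iv R₁ R₂ Ψrlf picMap deg M₁ M₂ r₁ r₂ Ψ Ψ^Base` holds for every `deg` and
all comparison functors `r_i` (`R_i = arithRealification hΦ_i`, `M_i = arithModelFrobenioid F_i K_i`): `deg(Ψ^rlf) = 1`,
and every `L₁` Galois over `ℚ` corresponds via `Ψ^Base` to `L₂ ≅ L₁` compatibly with an isomorphism `F₁ ≅ F₂`.
[cite: MochizukiFrdI2008, Thm. 6.4 (iv) p.115] -/
theorem Thm64iv_arith_of_datum [IsGalois ℚ F₁] :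
    ∃ (Ψrlf : PreFrobenioid.rlf (ModelFrobenioid.toElem (arithDivisorFunctor F₁ K₁) (unitsFunctor F₁ K₁)
          (divNatTrans F₁ K₁)) hΦ₁ ≌
        PreFrobenioid.rlf (ModelFrobenioid.toElem (arithDivisorFunctor F₂ K₂) (unitsFunctor F₂ K₂)
          (divNatTrans F₂ K₂)) hΦ₂)
      (picMap : ∀ A, (arithRealification hΦ₁).Pic A ≃+ (arithRealification hΦ₂).Pic (Ψrlf.functor.obj A)),
      Nonempty (Ψrlf.functor ⋙ (arithRealification hΦ₂).ops.base ≅ (arithRealification hΦ₁).ops.base ⋙ ΨBase) ∧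
      Thm64ii (arithRealification hΦ₁) (arithRealification hΦ₂) Ψrlf picMap ∧
      ∀ (deg : ℝ)
        (r₁ : arithFrobenioid F₁ K₁ ⥤ PreFrobenioid.rlf (ModelFrobenioid.toElem (arithDivisorFunctor F₁ K₁)
          (unitsFunctor F₁ K₁) (divNatTrans F₁ K₁)) hΦ₁)
        (r₂ : arithFrobenioid F₂ K₂ ⥤ PreFrobenioid.rlf (ModelFrobenioid.toElem (arithDivisorFunctor F₂ K₂)
          (unitsFunctor F₂ K₂) (divNatTrans F₂ K₂)) hΦ₂),
        Thm64iv (arithRealification hΦ₁) (arithRealification hΦ₂) Ψrlf picMap deg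
          (arithModelFrobenioid F₁ K₁) (arithModelFrobenioid F₂ K₂) r₁ r₂ Ψ ΨBase := by
  obtain ⟨Ψrlf, picMap, hηrlf, hT, gen⟩ :=
    exists_rlfData_and_generatorReadings_of_datum hΦ₁ hΦ₂ Ψ ΨBase E η hdiv π hπ
  exact ⟨Ψrlf, picMap, hηrlf, hT, fun deg r₁ r₂ =>
    Thm64iv_of_generatorReadings (arithRealification hΦ₁) (arithRealification hΦ₂) (arithModelFrobenioid F₁ K₁)
      (arithModelFrobenioid F₂ K₂) Ψrlf picMap deg r₁ r₂ Ψ ΨBase π gen⟩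

include η hdiv hπ in
/-- **The same with an explicit isomorphism `φ : F₁ ≅ F₂` in place of "`F₁` Galois over `ℚ`"** (the honest residual
of row T64iv/L07b, GAP-LEDGER G-L1t3-1, as an input). [cite: MochizukiFrdI2008, Thm. 6.4 (iv) p.115] -/
theorem Thm64iv_arith_of_datum_of_baseIso (φ : F₁ ≃+* F₂) :
    ∃ (Ψrlf : PreFrobenioid.rlf (ModelFrobenioid.toElem (arithDivisorFunctor F₁ K₁) (unitsFunctor F₁ K₁)
          (divNatTrans F₁ K₁)) hΦ₁ ≌
        PreFrobenioid.rlf (ModelFrobenioid.toElem (arithDivisorFunctor F₂ K₂) (unitsFunctor F₂ K₂)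
          (divNatTrans F₂ K₂)) hΦ₂)
      (picMap : ∀ A, (arithRealification hΦ₁).Pic A ≃+ (arithRealification hΦ₂).Pic (Ψrlf.functor.obj A)),
      Nonempty (Ψrlf.functor ⋙ (arithRealification hΦ₂).ops.base ≅ (arithRealification hΦ₁).ops.base ⋙ ΨBase) ∧
      Thm64ii (arithRealification hΦ₁) (arithRealification hΦ₂) Ψrlf picMap ∧
      ∀ (deg : ℝ)
        (r₁ : arithFrobenioid F₁ K₁ ⥤ PreFrobenioid.rlf (ModelFrobenioid.toElem (arithDivisorFunctor F₁ K₁)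
          (unitsFunctor F₁ K₁) (divNatTrans F₁ K₁)) hΦ₁)
        (r₂ : arithFrobenioid F₂ K₂ ⥤ PreFrobenioid.rlf (ModelFrobenioid.toElem (arithDivisorFunctor F₂ K₂)
          (unitsFunctor F₂ K₂) (divNatTrans F₂ K₂)) hΦ₂),
        Thm64iv (arithRealification hΦ₁) (arithRealification hΦ₂) Ψrlf picMap deg
          (arithModelFrobenioid F₁ K₁) (arithModelFrobenioid F₂ K₂) r₁ r₂ Ψ ΨBase := by
  obtain ⟨Ψrlf, picMap, hηrlf, hT, gen⟩ :=
    exists_rlfData_and_generatorReadings_of_datum hΦ₁ hΦ₂ Ψ ΨBase E η hdiv π hπ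
  exact ⟨Ψrlf, picMap, hηrlf, hT, fun deg r₁ r₂ =>
    Thm64iv_of_generatorReadings_of_baseIso (arithRealification hΦ₁) (arithRealification hΦ₂)
      (arithModelFrobenioid F₁ K₁) (arithModelFrobenioid F₂ K₂) Ψrlf picMap deg r₁ r₂ Ψ ΨBase φ π gen⟩

include η hdiv hπ in
/-- **"Then `deg(Ψ^rlf) = 1`"** read plainly, with no hypothesis on `F₁`, `F₂`: THE degree of Thm. 6.4 (ii) of THE
`Ψ^rlf` induced by the datum is `1`, i.e. THE induced `picMap` commutes with the `δ`'s on the nose; and every `X` with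
`X.L` Galois over `ℚ` corresponds via `Ψ^Base` to an isomorphic field (row T64iv/L07a). [cite: MochizukiFrdI2008, Thm. 6.4 (iv) p.115] -/
theorem Thm64iv_degOne_of_datum :
    ∃ (Ψrlf : PreFrobenioid.rlf (ModelFrobenioid.toElem (arithDivisorFunctor F₁ K₁) (unitsFunctor F₁ K₁)
          (divNatTrans F₁ K₁)) hΦ₁ ≌
        PreFrobenioid.rlf (ModelFrobenioid.toElem (arithDivisorFunctor F₂ K₂) (unitsFunctor F₂ K₂)
          (divNatTrans F₂ K₂)) hΦ₂)
      (picMap : ∀ A, (arithRealification hΦ₁).Pic A ≃+ (arithRealification hΦ₂).Pic (Ψrlf.functor.obj A)),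
      Nonempty (Ψrlf.functor ⋙ (arithRealification hΦ₂).ops.base ≅ (arithRealification hΦ₁).ops.base ⋙ ΨBase) ∧
      Thm64iiDeg (arithRealification hΦ₁) (arithRealification hΦ₂) Ψrlf picMap 1 ∧
      ∀ X : FinSubextCat F₁ K₁, IsGalois ℚ X.L → Nonempty (X.L ≃+* (ΨBase.obj X).L) := by
  obtain ⟨Ψrlf, picMap, hηrlf, ⟨deg, hdeg⟩, gen⟩ :=
    exists_rlfData_and_generatorReadings_of_datum hΦ₁ hΦ₂ Ψ ΨBase E η hdiv π hπ
  obtain ⟨h1, hiso⟩ := Thm64iv_degOne_and_fieldIso_of_generatorReadings (arithRealification hΦ₁)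
    (arithRealification hΦ₂) Ψrlf picMap deg hdeg ΨBase π gen
  exact ⟨Ψrlf, picMap, hηrlf, h1 ▸ hdeg, hiso⟩

end AtData

end Literature.AlgebraicGeometry.Frobenioids

end
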